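import Summits.CriticalPhenomena.SAWScalingLimit.Theorems.SAWDefectDecoherenceBoundaryClosureRPolygonGreenPairing
import HarnessLib

/-!
# Polygon limit data, III: masses at one mesh — off-closure edges and boundary darts
(crux `BoundaryClosureR`, stmt-CriticalPhenomena-14004, line `polygon-parity-squeeze`, registered
stub `polygonLimitData` = piece C1 of the (A) assembly of `stub_polygonIdentification`)

One-mesh estimates, after the budget cover of `…PolygonGreenPairing.lean` (budget balls at boundary
points off the root + a bulk set `T` of deep vertices), for a domain `Λ` rooted at the dart `{u, w}`:

* `finsum_midEdges_le_sum_nbrs` — a window sum over mid-edges is dominated by the vertex–neighbour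
  double sum (every mid-edge of `Ω(Λ)` has an endpoint in `Λ`);
* `offClosure_mesh_le` — the `σ = 5/8` mass of the mid-edges whose scaled midpoint lies in `S` but
  OFF `closure Ω` is `≤ 768 (Σ_x C_x) δ⁻¹ Z(b)`, PROVIDED such edges hang at vertices of metric depth
  `< 16` (which `…PolygonLimitDataEscape.lean` derives from the exact polygon charts): the mass of such
  an edge is at most the star mass at its vertex (`PolygonGreen.norm_obs_zero_dart_le` for darts), the
  vertex lies in a budget ball, and the layers `k < 16` of the budgets are summed
  (`PolygonGreen.layerCake_depth_le`);
* `dart_mesh_le` — the `σ = 0` mass of the boundary darts with scaled midpoint in `S` is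
  `≤ 3 (Σ_x C_x) δ⁻¹ Z(b)` (depth-`0` layer only; the form consumed by `sideMeasure_weakStarLimit`).
-/

noncomputable section

open scoped BigOperators Topology Classical
open Filter Set Metric
open Literature.Probability.LatticeModels Literature.Probability.RandomPlanarGeometry
open Literature.Probability.RandomPlanarGeometry.SAW
open Literature.Barriers.CriticalPhenomena.HexGreen (nbrs mem_nbrs_iff)
open Summit.CriticalPhenomena.SAWScalingLimit.Theorems.PickHalfPlane
open Summit.CriticalPhenomena.SAWScalingLimit.Theorems.ObservableToSLE.FloorRatio (dist_smul_mesh)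
open Summit.CriticalPhenomena.SAWScalingLimit.Theorems.DecoherenceSynthesis (norm_hexMidpoint_sub_hexCenter_le)
open Summit.CriticalPhenomena.SAWScalingLimit.Cruxes.DefectDecoherence.TipMartingaleDepthInduction.WallExitTwoPoint
  (dist_hexCenter_le_one_of_adj)
open Summit.CriticalPhenomena.SAWScalingLimit.Theorems.MassRatio.Negative (hexDomainMidEdges_finite)
open Summit.CriticalPhenomena.SAWScalingLimit.Theorems.PolygonParitySqueeze.PolygonGreen

namespace Summit.CriticalPhenomena.SAWScalingLimit.Theorems.PolygonParitySqueeze.PolygonLimitData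

/-! ### 1. Window sums over mid-edges versus vertex sums -/

/-- Every face has at most three neighbours. [folklore] -/
theorem card_nbrs_le (v : HexVertex) : (nbrs v).card ≤ 3 := by
  unfold nbrs
  split_ifs <;> exact Finset.card_le_three

/-- **Window sums are dominated by vertex–neighbour sums.** For non-negative `f` and any window
predicate `P`: `Σᶠ_{z ∈ Ω(Λ), P z} f z ≤ Σ_{v ∈ Λ} Σ_{t ∼ v} 1_{P {v,t}} f {v,t}` (every mid-edge of
`Ω(Λ)` has an endpoint in `Λ`). [cite: DuminilCopinSmirnov2012, §2 (domains)] -/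
theorem finsum_midEdges_le_sum_nbrs (Λ : Finset HexVertex) (P : Sym2 HexVertex → Prop) [DecidablePred P]
    (f : Sym2 HexVertex → ℝ) (hf : ∀ z, 0 ≤ f z) :
    ∑ᶠ z ∈ {z : Sym2 HexVertex | z ∈ hexDomainMidEdges Λ ∧ P z}, f z ≤
      ∑ v ∈ Λ, ∑ t ∈ nbrs v, (if P s(v, t) then f s(v, t) else 0) := by
  classical
  have hW : {z : Sym2 HexVertex | z ∈ hexDomainMidEdges Λ ∧ P z}.Finite :=
    GateMass.finite_midEdgeWindow Λ P
  rw [finsum_mem_eq_finite_toFinset_sum _ hW]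
  set g : Sym2 HexVertex → ℝ := fun z => if P z then f z else 0 with hg
  have hg0 : ∀ z, 0 ≤ g z := fun z => by simp only [hg]; split_ifs; exacts [hf z, le_rfl]
  set Sg : Finset ((_ : HexVertex) × HexVertex) := Λ.sigma fun v => nbrs v with hSg
  have himg : hW.toFinset ⊆ Sg.image fun p => s(p.1, p.2) := by
    intro z hz
    rw [Set.Finite.mem_toFinset] at hz
    obtain ⟨⟨he, v, hvz, hvΛ⟩, -⟩ := hz
    obtain ⟨t, ht⟩ : ∃ t, z = s(v, t) := ⟨Sym2.Mem.other hvz, (Sym2.other_spec hvz).symm⟩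
    have hadj : hexGraph.Adj v t := by
      rw [ht] at he; exact (SimpleGraph.mem_edgeSet hexGraph).1 he
    exact Finset.mem_image.2 ⟨⟨v, t⟩, Finset.mem_sigma.2 ⟨hvΛ, (mem_nbrs_iff v t).2 hadj⟩, ht.symm⟩
  calc ∑ z ∈ hW.toFinset, f z = ∑ z ∈ hW.toFinset, g z := Finset.sum_congr rfl fun z hz => by
          rw [Set.Finite.mem_toFinset] at hz; simp only [hg, if_pos hz.2]
    _ ≤ ∑ z ∈ Sg.image (fun p => s(p.1, p.2)), g z :=
        Finset.sum_le_sum_of_subset_of_nonneg himg fun z _ _ => hg0 z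
    _ ≤ ∑ p ∈ Sg, g s(p.1, p.2) := Finset.sum_image_le_of_nonneg fun z _ => hg0 z
    _ = ∑ v ∈ Λ, ∑ t ∈ nbrs v, g s(v, t) := Finset.sum_sigma _ _ _

/-! ### 2. Off-closure edges at one mesh -/

/-- **The off-closure mass at one mesh, after the cover.** Let `Λ` be rooted at the dart `{u, w}`
(`u ∉ Λ`), with metric depths `≤ Kd`, budget balls `B(x, rb x)` (`x ∈ t`) with constants `C_x ≥ 0`
and inner radii `r x ≤ rb x`; vertices carrying an edge with scaled midpoint in `S ∖ closure Ω` of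
metric depth `< 16`; bulk vertices (scaled centre in `T`) whose edges have scaled midpoints in
`closure Ω`; the cover of the `δ/2`-thickening of `S` by the balls `B(x, r x)` and `T`; and no edge
at the root vertex `w` with scaled midpoint in `S`.  Then
`δ² Σ_{z ∈ Ω(Λ), δ mid z ∈ S ∖ closure Ω} ‖F_{5/8}(z)‖ ≤ 768 (Σ_x C_x) δ Z(b)`.
[cite: DuminilCopinSmirnov2012, §2 (walks between mid-edges)] -/
theorem offClosure_mesh_le {Λ : Finset HexVertex} {u w : HexVertex} {b : Sym2 HexVertex} {δ : ℝ} {Kd : ℕ}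
    {t : Finset ℂ} {r rb Cb : ℂ → ℝ} {Ω T S : Set ℂ} (hu : u ∉ Λ) (hδ : 0 < δ)
    (hdepthK : ∀ v ∈ Λ, ∀ k : ℕ, IsMetricDepth Λ v k → k ≤ Kd)
    (hCb : ∀ x ∈ t, 0 ≤ Cb x) (hrb : ∀ x ∈ t, r x ≤ rb x)
    (hbudget : ∀ x ∈ t, ∀ k : ℕ, δ * (∑ᶠ v ∈ {v : HexVertex | v ∈ Λ ∧
        (δ : ℂ) * hexCenter v ∈ ball x (rb x) ∧ IsMetricDepth Λ v k}, starMass Λ s(u, w) v) ≤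
      Cb x * ((k : ℝ) + 1) ^ (3 / 4 : ℝ) * ‖hexParafermionicObservable Λ s(u, w) hexCriticalFugacity 0 b‖)
    (hdep : ∀ v ∈ Λ, ∀ t' : HexVertex, hexGraph.Adj v t' → (δ : ℂ) * hexMidpoint s(v, t') ∈ S →
      (δ : ℂ) * hexMidpoint s(v, t') ∉ closure Ω → ∀ j : ℕ, IsMetricDepth Λ v j → j < 16)
    (hTcl : ∀ v ∈ Λ, (δ : ℂ) * hexCenter v ∈ T → ∀ t' : HexVertex, hexGraph.Adj v t' →
      (δ : ℂ) * hexMidpoint s(v, t') ∈ closure Ω)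
    (hsplit : ∀ v ∈ Λ, (δ : ℂ) * hexCenter v ∈ cthickening (δ / 2) S →
      (∃ x ∈ t, (δ : ℂ) * hexCenter v ∈ ball x (r x)) ∨ (δ : ℂ) * hexCenter v ∈ T)
    (hroot : ∀ t' : HexVertex, hexGraph.Adj w t' → (δ : ℂ) * hexMidpoint s(w, t') ∉ S) :
    δ ^ 2 * (∑ᶠ z ∈ {z : Sym2 HexVertex | z ∈ hexDomainMidEdges Λ ∧
        ((δ : ℂ) * hexMidpoint z ∈ S ∧ (δ : ℂ) * hexMidpoint z ∉ closure Ω)},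
      ‖hexParafermionicObservable Λ s(u, w) hexCriticalFugacity (5 / 8) z‖) ≤
      768 * (∑ x ∈ t, Cb x) * δ * ‖hexParafermionicObservable Λ s(u, w) hexCriticalFugacity 0 b‖ := by
  classical
  set a : Sym2 HexVertex := s(u, w) with ha
  set F : Sym2 HexVertex → ℂ := hexParafermionicObservable Λ a hexCriticalFugacity (5 / 8) with hFdef
  set Z : Sym2 HexVertex → ℂ := hexParafermionicObservable Λ a hexCriticalFugacity 0 with hZdef
  set Zb : ℝ := ‖Z b‖ with hZbdef
  have hx1 : hexCriticalFugacity ≤ 1 := hexCriticalFugacity_pos_lt_one.2.le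
  have hstar0 : ∀ v, 0 ≤ starMass Λ a v := fun v => Finset.sum_nonneg fun t _ => norm_nonneg _
  have hCbs : 0 ≤ ∑ x ∈ t, Cb x := Finset.sum_nonneg hCb
  -- predicates and the vertex functional
  set bad : Sym2 HexVertex → Prop := fun z =>
    (δ : ℂ) * hexMidpoint z ∈ S ∧ (δ : ℂ) * hexMidpoint z ∉ closure Ω with hbad
  set A : HexVertex → Prop := fun v => ∃ t' ∈ nbrs v, bad s(v, t') with hA
  set Φ : HexVertex → ℝ := fun v =>
    if (∀ j : ℕ, IsMetricDepth Λ v j → j < 16) then 3 * starMass Λ a v else 0 with hΦ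
  have hΦ0 : ∀ v, 0 ≤ Φ v := fun v => by
    simp only [hΦ]; split_ifs
    · exact mul_nonneg (by norm_num) (hstar0 v)
    · exact le_rfl
  have hΦle : ∀ v, Φ v ≤ 3 * starMass Λ a v := fun v => by
    simp only [hΦ]; split_ifs
    · exact le_rfl
    · exact mul_nonneg (by norm_num) (hstar0 v)
  ---------------------------------------------------------------- (1) geometry of a bad edge
  have hgeo : ∀ v ∈ Λ, ∀ t' ∈ nbrs v, bad s(v, t') →
      v ≠ w ∧ (∃ x ∈ t, (δ : ℂ) * hexCenter v ∈ ball x (r x)) ∧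
        (∀ j : ℕ, IsMetricDepth Λ v j → j < 16) := by
    intro v hv t' ht' hb
    have hadj : hexGraph.Adj v t' := (mem_nbrs_iff v t').1 ht'
    obtain ⟨hS, hcl⟩ := hb
    have hvw : v ≠ w := by rintro rfl; exact hroot t' hadj hS
    have hdist : dist ((δ : ℂ) * hexMidpoint s(v, t')) ((δ : ℂ) * hexCenter v) ≤ δ / 2 := by
      rw [dist_smul_mesh hδ.le, dist_eq_norm]
      exact (mul_le_mul_of_nonneg_left (norm_hexMidpoint_sub_hexCenter_le hadj) hδ.le).trans (by linarith)
    have hth : (δ : ℂ) * hexCenter v ∈ cthickening (δ / 2) S :=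
      mem_cthickening_of_dist_le _ _ _ _ hS (by rw [dist_comm]; exact hdist)
    have hball : ∃ x ∈ t, (δ : ℂ) * hexCenter v ∈ ball x (r x) := by
      rcases hsplit v hv hth with h | hT
      · exact h
      · exact absurd (hTcl v hv hT t' hadj) hcl
    exact ⟨hvw, hball, hdep v hv t' hadj hS hcl⟩
  ---------------------------------------------------------------- (2) per-vertex bound
  have hvert : ∀ v ∈ Λ, ∑ t' ∈ nbrs v, (if bad s(v, t') then ‖F s(v, t')‖ else 0) ≤
      if A v then Φ v else 0 := by
    intro v hv
    by_cases hAv : A v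
    · obtain ⟨t₀, ht₀, hb₀⟩ := hAv
      obtain ⟨hvw, -, hdep⟩ := hgeo v hv t₀ ht₀ hb₀
      rw [if_pos ⟨t₀, ht₀, hb₀⟩]
      have hΦv : Φ v = 3 * starMass Λ a v := by simp only [hΦ, if_pos hdep]
      rw [hΦv]
      have hterm : ∀ t' ∈ nbrs v, (if bad s(v, t') then ‖F s(v, t')‖ else 0) ≤ starMass Λ a v := by
        intro t' ht'
        split_ifs
        · have hadj : hexGraph.Adj v t' := (mem_nbrs_iff v t').1 ht'
          refine (GateMass.norm_obs_le_norm_obs_zero Λ a (5 / 8) s(v, t')).trans ?_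
          by_cases ht'Λ : t' ∈ Λ
          · rw [starMass]
            exact Finset.single_le_sum (f := fun t => ‖Z s(v, t)‖) (fun _ _ => norm_nonneg _)
              (Finset.mem_filter.2 ⟨ht'Λ, hadj⟩)
          · exact (norm_obs_zero_dart_le hu hv ht'Λ hvw).trans (mul_le_of_le_one_left (hstar0 v) hx1)
        · exact hstar0 v
      calc ∑ t' ∈ nbrs v, (if bad s(v, t') then ‖F s(v, t')‖ else 0)
          ≤ ∑ _t' ∈ nbrs v, starMass Λ a v := Finset.sum_le_sum hterm
        _ ≤ 3 * starMass Λ a v := by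
            rw [Finset.sum_const, nsmul_eq_mul]
            exact mul_le_mul_of_nonneg_right (by exact_mod_cast card_nbrs_le v) (hstar0 v)
    · rw [if_neg hAv]
      refine (Finset.sum_eq_zero fun t' ht' => ?_).le
      rw [if_neg]
      exact fun hb => hAv ⟨t', ht', hb⟩
  ---------------------------------------------------------------- (3) the cover
  have hsplit' : ∀ v ∈ Λ, A v → (∃ x ∈ t, (δ : ℂ) * hexCenter v ∈ ball x (r x)) ∨ False :=
    fun v hv ⟨t', ht', hb⟩ => Or.inl (hgeo v hv t' ht' hb).2.1
  have hcov := sum_filter_le_of_cover Λ t A (fun _ => False)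
    (fun x v => (δ : ℂ) * hexCenter v ∈ ball x (r x)) Φ hΦ0 hsplit'
  simp only [Finset.filter_false, Finset.sum_empty, add_zero] at hcov
  ---------------------------------------------------------------- (4) per ball: layers `k < 16`
  have hball : ∀ x ∈ t, δ * ∑ v ∈ Λ.filter (fun v => (δ : ℂ) * hexCenter v ∈ ball x (r x)), Φ v ≤
      Cb x * Zb * 768 := by
    intro x hx
    have hmono : ∑ v ∈ Λ.filter (fun v => (δ : ℂ) * hexCenter v ∈ ball x (r x)), Φ v ≤
        ∑ v ∈ Λ.filter (fun v => (δ : ℂ) * hexCenter v ∈ ball x (rb x)), Φ v := by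
      refine Finset.sum_le_sum_of_subset_of_nonneg (fun v hv => ?_) fun v _ _ => hΦ0 v
      rw [Finset.mem_filter] at hv ⊢
      exact ⟨hv.1, ball_subset_ball (hrb x hx) hv.2⟩
    set wt : ℕ → ℝ := fun k => if k < 16 then 3 else 0 with hwt
    have hwt0 : ∀ k, 0 ≤ wt k := fun k => by simp only [hwt]; split_ifs <;> norm_num
    have hcake := layerCake_depth_le (a := a) hδ.le (hbudget x hx) hdepthK wt hwt0 Φ (fun v _ k hk => by
      by_cases hk16 : k < 16
      · simp only [hwt, if_pos hk16]; exact hΦle v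
      · have h0 : Φ v = 0 := by simp only [hΦ]; rw [if_neg]; exact fun h => hk16 (h k hk)
        rw [h0]; exact mul_nonneg (hwt0 k) (hstar0 v))
    have hsum : ∑ k ∈ Finset.range (Kd + 1), wt k * ((k : ℝ) + 1) ^ (3 / 4 : ℝ) ≤ 768 := by
      have hterm : ∀ k ∈ Finset.range (Kd + 1), wt k * ((k : ℝ) + 1) ^ (3 / 4 : ℝ) ≤
          if k < 16 then (48 : ℝ) else 0 := by
        intro k _
        simp only [hwt]
        split_ifs with hk
        · have hk1 : (k : ℝ) + 1 ≤ 16 := by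
            have : k + 1 ≤ 16 := hk
            exact_mod_cast this
          have hpow : ((k : ℝ) + 1) ^ (3 / 4 : ℝ) ≤ 16 :=
            calc ((k : ℝ) + 1) ^ (3 / 4 : ℝ) ≤ ((k : ℝ) + 1) ^ (1 : ℝ) :=
                  Real.rpow_le_rpow_of_exponent_le (by linarith [(Nat.cast_nonneg k : (0 : ℝ) ≤ k)]) (by norm_num)
              _ = (k : ℝ) + 1 := Real.rpow_one _
              _ ≤ 16 := hk1
          linarith
        · simp
      calc ∑ k ∈ Finset.range (Kd + 1), wt k * ((k : ℝ) + 1) ^ (3 / 4 : ℝ)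
          ≤ ∑ k ∈ Finset.range (Kd + 1), (if k < 16 then (48 : ℝ) else 0) := Finset.sum_le_sum hterm
        _ = ∑ k ∈ (Finset.range (Kd + 1)).filter (fun k => k < 16), (48 : ℝ) := (Finset.sum_filter _ _).symm
        _ = 48 * ((Finset.range (Kd + 1)).filter (fun k => k < 16)).card := by
            rw [Finset.sum_const, nsmul_eq_mul, mul_comm]
        _ ≤ 48 * 16 := by
            gcongr
            have hsub : (Finset.range (Kd + 1)).filter (fun k => k < 16) ⊆ Finset.range 16 := fun k hk =>
              Finset.mem_range.2 (Finset.mem_filter.1 hk).2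
            exact_mod_cast (Finset.card_le_card hsub).trans (by rw [Finset.card_range])
        _ = 768 := by norm_num
    calc δ * ∑ v ∈ Λ.filter (fun v => (δ : ℂ) * hexCenter v ∈ ball x (r x)), Φ v
        ≤ δ * ∑ v ∈ Λ.filter (fun v => (δ : ℂ) * hexCenter v ∈ ball x (rb x)), Φ v :=
          mul_le_mul_of_nonneg_left hmono hδ.le
      _ ≤ Cb x * Zb * ∑ k ∈ Finset.range (Kd + 1), wt k * ((k : ℝ) + 1) ^ (3 / 4 : ℝ) := hcake
      _ ≤ Cb x * Zb * 768 := mul_le_mul_of_nonneg_left hsum (mul_nonneg (hCb x hx) (norm_nonneg _))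
  ---------------------------------------------------------------- (5) combine
  have h1 := finsum_midEdges_le_sum_nbrs Λ bad (fun z => ‖F z‖) (fun z => norm_nonneg _)
  have h2 : ∑ v ∈ Λ, ∑ t' ∈ nbrs v, (if bad s(v, t') then ‖F s(v, t')‖ else 0) ≤ ∑ v ∈ Λ.filter A, Φ v := by
    rw [Finset.sum_filter]
    exact Finset.sum_le_sum hvert
  calc δ ^ 2 * (∑ᶠ z ∈ {z : Sym2 HexVertex | z ∈ hexDomainMidEdges Λ ∧ bad z}, ‖F z‖)
      ≤ δ ^ 2 * ∑ v ∈ Λ.filter A, Φ v := mul_le_mul_of_nonneg_left (h1.trans h2) (sq_nonneg _)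
    _ ≤ δ ^ 2 * ∑ x ∈ t, ∑ v ∈ Λ.filter (fun v => (δ : ℂ) * hexCenter v ∈ ball x (r x)), Φ v :=
        mul_le_mul_of_nonneg_left hcov (sq_nonneg _)
    _ = δ * ∑ x ∈ t, δ * ∑ v ∈ Λ.filter (fun v => (δ : ℂ) * hexCenter v ∈ ball x (r x)), Φ v := by
        rw [Finset.mul_sum, Finset.mul_sum]
        exact Finset.sum_congr rfl fun x _ => by ring
    _ ≤ δ * ∑ x ∈ t, Cb x * Zb * 768 := mul_le_mul_of_nonneg_left (Finset.sum_le_sum hball) hδ.le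
    _ = 768 * (∑ x ∈ t, Cb x) * δ * Zb := by rw [← Finset.sum_mul, ← Finset.sum_mul]; ring

/-! ### 3. Boundary darts at one mesh -/

/-- **The dart mass at one mesh, after the cover.** Let `Λ` be rooted at the dart `{u, w}`
(`u ∉ Λ`), with metric depths `≤ Kd`, budget balls `B(x, r x)` (`x ∈ t`, constants `C_x`), bulk
vertices (scaled centre in `T`) that are `1`-deep, the cover of the `δ/2`-thickening of `S`, and no
edge at the root vertex `w` with scaled midpoint in `S`.  Then the `σ = 0` mass of the boundary
darts with scaled midpoint in `S` satisfies `δ Σ ‖Z(e)‖ ≤ 3 (Σ_x C_x) Z(b)` (darts hang at depth-`0`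
vertices; dangling mass bound and the depth-`0` layer of the budgets).
[cite: DuminilCopinSmirnov2012, §2 (walks between mid-edges)] -/
theorem dart_mesh_le {Λ : Finset HexVertex} {u w : HexVertex} {b : Sym2 HexVertex} {δ : ℝ} {Kd : ℕ}
    {t : Finset ℂ} {r Cb : ℂ → ℝ} {T S : Set ℂ} (hu : u ∉ Λ) (hδ : 0 < δ)
    (hdepthK : ∀ v ∈ Λ, ∀ k : ℕ, IsMetricDepth Λ v k → k ≤ Kd)
    (hbudget : ∀ x ∈ t, ∀ k : ℕ, δ * (∑ᶠ v ∈ {v : HexVertex | v ∈ Λ ∧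
        (δ : ℂ) * hexCenter v ∈ ball x (r x) ∧ IsMetricDepth Λ v k}, starMass Λ s(u, w) v) ≤
      Cb x * ((k : ℝ) + 1) ^ (3 / 4 : ℝ) * ‖hexParafermionicObservable Λ s(u, w) hexCriticalFugacity 0 b‖)
    (hdeep : ∀ v ∈ Λ, (δ : ℂ) * hexCenter v ∈ T → ∀ y : HexVertex, dist (hexCenter y) (hexCenter v) ≤ 1 → y ∈ Λ)
    (hsplit : ∀ v ∈ Λ, (δ : ℂ) * hexCenter v ∈ cthickening (δ / 2) S →
      (∃ x ∈ t, (δ : ℂ) * hexCenter v ∈ ball x (r x)) ∨ (δ : ℂ) * hexCenter v ∈ T)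
    (hroot : ∀ t' : HexVertex, hexGraph.Adj w t' → (δ : ℂ) * hexMidpoint s(w, t') ∉ S) :
    δ * (∑ᶠ e ∈ {e : Sym2 HexVertex | e ∈ hexDomainBoundary Λ ∧ (δ : ℂ) * hexMidpoint e ∈ S},
      ‖hexParafermionicObservable Λ s(u, w) hexCriticalFugacity 0 e‖) ≤
      3 * (∑ x ∈ t, Cb x) * ‖hexParafermionicObservable Λ s(u, w) hexCriticalFugacity 0 b‖ := by
  classical
  set a : Sym2 HexVertex := s(u, w) with ha
  set Z : Sym2 HexVertex → ℂ := hexParafermionicObservable Λ a hexCriticalFugacity 0 with hZdef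
  set Zb : ℝ := ‖Z b‖ with hZbdef
  have hx1 : hexCriticalFugacity ≤ 1 := hexCriticalFugacity_pos_lt_one.2.le
  have hstar0 : ∀ v, 0 ≤ starMass Λ a v := fun v => Finset.sum_nonneg fun t _ => norm_nonneg _
  set g : Sym2 HexVertex → ℝ := fun e => if (δ : ℂ) * hexMidpoint e ∈ S then ‖Z e‖ else 0 with hg
  have hg0 : ∀ e, 0 ≤ g e := fun e => by simp only [hg]; split_ifs <;> positivity
  set A : HexVertex → Prop := fun v => ∃ t' ∈ (nbrs v).filter (· ∉ Λ), (δ : ℂ) * hexMidpoint s(v, t') ∈ S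
    with hA
  set Φ : HexVertex → ℝ := fun v => if IsMetricDepth Λ v 0 then 3 * starMass Λ a v else 0 with hΦ
  have hΦ0 : ∀ v, 0 ≤ Φ v := fun v => by
    simp only [hΦ]; split_ifs
    · exact mul_nonneg (by norm_num) (hstar0 v)
    · exact le_rfl
  ---------------------------------------------------------------- (1) window → darts
  have hfin : (hexDomainBoundary Λ).Finite := (hexDomainMidEdges_finite Λ).subset (hexDomainBoundary_subset Λ)
  have h1 : ∑ᶠ e ∈ {e : Sym2 HexVertex | e ∈ hexDomainBoundary Λ ∧ (δ : ℂ) * hexMidpoint e ∈ S}, ‖Z e‖ ≤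
      ∑ᶠ e ∈ hexDomainBoundary Λ, g e :=
    finsum_mem_le_finsum_mem_of_subset hfin (fun e he => he.1)
      (fun e he => by simp only [hg, if_pos he.2]; exact le_rfl) hg0
  rw [finsum_boundary_eq_sum_darts] at h1
  ---------------------------------------------------------------- (2) geometry of a dart
  have hgeo : ∀ v ∈ Λ, ∀ t' ∈ (nbrs v).filter (· ∉ Λ), (δ : ℂ) * hexMidpoint s(v, t') ∈ S →
      v ≠ w ∧ IsMetricDepth Λ v 0 ∧ (∃ x ∈ t, (δ : ℂ) * hexCenter v ∈ ball x (r x)) := by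
    intro v hv t' ht' hS
    obtain ⟨ht'n, ht'Λ⟩ := Finset.mem_filter.1 ht'
    have hadj : hexGraph.Adj v t' := (mem_nbrs_iff v t').1 ht'n
    have hvw : v ≠ w := by rintro rfl; exact hroot t' hadj hS
    have hdist : dist ((δ : ℂ) * hexMidpoint s(v, t')) ((δ : ℂ) * hexCenter v) ≤ δ / 2 := by
      rw [dist_smul_mesh hδ.le, dist_eq_norm]
      exact (mul_le_mul_of_nonneg_left (norm_hexMidpoint_sub_hexCenter_le hadj) hδ.le).trans (by linarith)
    have hth : (δ : ℂ) * hexCenter v ∈ cthickening (δ / 2) S :=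
      mem_cthickening_of_dist_le _ _ _ _ hS (by rw [dist_comm]; exact hdist)
    refine ⟨hvw, isMetricDepth_zero_of_dart hv hadj ht'Λ, ?_⟩
    rcases hsplit v hv hth with h | hT
    · exact h
    · exact absurd (hdeep v hv hT t' (dist_hexCenter_le_one_of_adj hadj)) ht'Λ
  ---------------------------------------------------------------- (3) per-vertex bound
  have hvert : ∀ v ∈ Λ, ∑ t' ∈ (nbrs v).filter (· ∉ Λ), g s(v, t') ≤ if A v then Φ v else 0 := by
    intro v hv
    by_cases hAv : A v
    · obtain ⟨t₀, ht₀, hS₀⟩ := hAv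
      obtain ⟨hvw, hdep, -⟩ := hgeo v hv t₀ ht₀ hS₀
      rw [if_pos ⟨t₀, ht₀, hS₀⟩]
      have hΦv : Φ v = 3 * starMass Λ a v := by simp only [hΦ, if_pos hdep]
      rw [hΦv]
      have hterm : ∀ t' ∈ (nbrs v).filter (· ∉ Λ), g s(v, t') ≤ starMass Λ a v := by
        intro t' ht'
        obtain ⟨-, ht'Λ⟩ := Finset.mem_filter.1 ht'
        simp only [hg]
        split_ifs
        · exact (norm_obs_zero_dart_le hu hv ht'Λ hvw).trans (mul_le_of_le_one_left (hstar0 v) hx1)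
        · exact hstar0 v
      calc ∑ t' ∈ (nbrs v).filter (· ∉ Λ), g s(v, t') ≤ ∑ _t' ∈ (nbrs v).filter (· ∉ Λ), starMass Λ a v :=
            Finset.sum_le_sum hterm
        _ ≤ 3 * starMass Λ a v := by
            rw [Finset.sum_const, nsmul_eq_mul]
            exact mul_le_mul_of_nonneg_right (by exact_mod_cast card_filter_nbrs_le v _) (hstar0 v)
    · rw [if_neg hAv]
      refine (Finset.sum_eq_zero fun t' ht' => ?_).le
      simp only [hg]
      rw [if_neg]
      exact fun hS => hAv ⟨t', ht', hS⟩
  ---------------------------------------------------------------- (4) cover and depth-zero layer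
  have hsplit' : ∀ v ∈ Λ, A v → (∃ x ∈ t, (δ : ℂ) * hexCenter v ∈ ball x (r x)) ∨ False :=
    fun v hv ⟨t', ht', hS⟩ => Or.inl (hgeo v hv t' ht' hS).2.2
  have hcov := sum_filter_le_of_cover Λ t A (fun _ => False)
    (fun x v => (δ : ℂ) * hexCenter v ∈ ball x (r x)) Φ hΦ0 hsplit'
  simp only [Finset.filter_false, Finset.sum_empty, add_zero] at hcov
  have hball : ∀ x ∈ t, δ * ∑ v ∈ Λ.filter (fun v => (δ : ℂ) * hexCenter v ∈ ball x (r x)), Φ v ≤ Cb x * Zb * 3 := by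
    intro x hx
    set wt : ℕ → ℝ := fun k => if k = 0 then 3 else 0 with hwt
    have hwt0 : ∀ k, 0 ≤ wt k := fun k => by simp only [hwt]; split_ifs <;> norm_num
    have hcake := layerCake_depth_le (a := a) hδ.le (hbudget x hx) hdepthK wt hwt0 Φ (fun v _ k hk => by
      simp only [hΦ, hwt]
      by_cases hk0 : k = 0
      · subst hk0; rw [if_pos hk, if_pos rfl]
      · rw [if_neg (fun h0 => hk0 (isMetricDepth_unique hk h0)), if_neg hk0, zero_mul])
    have hsum : ∑ k ∈ Finset.range (Kd + 1), wt k * ((k : ℝ) + 1) ^ (3 / 4 : ℝ) = 3 := by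
      rw [Finset.sum_eq_single 0 (fun k _ hk => by simp only [hwt, if_neg hk, zero_mul])
        (fun h => absurd (Finset.mem_range.2 (Nat.succ_pos Kd)) h)]
      simp [hwt]
    rw [hsum] at hcake
    exact hcake
  ---------------------------------------------------------------- (5) combine
  have h2 : ∑ v ∈ Λ, ∑ t' ∈ (nbrs v).filter (· ∉ Λ), g s(v, t') ≤ ∑ v ∈ Λ.filter A, Φ v := by
    rw [Finset.sum_filter]
    exact Finset.sum_le_sum hvert
  calc δ * (∑ᶠ e ∈ {e : Sym2 HexVertex | e ∈ hexDomainBoundary Λ ∧ (δ : ℂ) * hexMidpoint e ∈ S}, ‖Z e‖)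
      ≤ δ * ∑ v ∈ Λ.filter A, Φ v := mul_le_mul_of_nonneg_left (h1.trans h2) hδ.le
    _ ≤ δ * ∑ x ∈ t, ∑ v ∈ Λ.filter (fun v => (δ : ℂ) * hexCenter v ∈ ball x (r x)), Φ v :=
        mul_le_mul_of_nonneg_left hcov hδ.le
    _ = ∑ x ∈ t, δ * ∑ v ∈ Λ.filter (fun v => (δ : ℂ) * hexCenter v ∈ ball x (r x)), Φ v := Finset.mul_sum _ _ _
    _ ≤ ∑ x ∈ t, Cb x * Zb * 3 := Finset.sum_le_sum hball
    _ = 3 * (∑ x ∈ t, Cb x) * Zb := by rw [← Finset.sum_mul, ← Finset.sum_mul]; ring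

/-! ### Registered form -/

/-- **Registered helper `polygonLimitData_offClosureMesh`** (crux item stmt-CriticalPhenomena-14004, line
`polygon-parity-squeeze`, sub-goal of the stub `polygonLimitData`): registry form (one `∀`-term) of
`offClosure_mesh_le`. [cite: DuminilCopinSmirnov2012, §2 (walks between mid-edges)] -/
theorem polygonLimitData_offClosureMesh : ∀ (Λ : Finset HexVertex) (u w : HexVertex) (b : Sym2 HexVertex) (δ : ℝ) (Kd : ℕ) (t : Finset ℂ) (r rb Cb : ℂ → ℝ) (Ω T S : Set ℂ), u ∉ Λ → 0 < δ → (∀ v ∈ Λ, ∀ k : ℕ, IsMetricDepth Λ v k → k ≤ Kd) → (∀ x ∈ t, 0 ≤ Cb x) → (∀ x ∈ t, r x ≤ rb x) → (∀ x ∈ t, ∀ k : ℕ, δ * (∑ᶠ v ∈ {v : HexVertex | v ∈ Λ ∧ (δ : ℂ) * hexCenter v ∈ Metric.ball x (rb x) ∧ IsMetricDepth Λ v k}, starMass Λ s(u, w) v) ≤ Cb x * ((k : ℝ) + 1) ^ (3 / 4 : ℝ) * ‖hexParafermionicObservable Λ s(u, w) hexCriticalFugacity 0 b‖) → (∀ v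 ∈ Λ, ∀ t' : HexVertex, hexGraph.Adj v t' → (δ : ℂ) * hexMidpoint s(v, t') ∈ S → (δ : ℂ) * hexMidpoint s(v, t') ∉ closure Ω → ∀ j : ℕ, IsMetricDepth Λ v j → j < 16) → (∀ v ∈ Λ, (δ : ℂ) * hexCenter v ∈ T → ∀ t' : HexVertex, hexGraph.Adj v t' → (δ : ℂ) * hexMidpoint s(v, t') ∈ closure Ω) → (∀ v ∈ Λ, (δ : ℂ) * hexCenter v ∈ Metric.cthickening (δ / 2) S → (∃ x ∈ t, (δ : ℂ) * hexCenter v ∈ Metric.ball x (r x)) ∨ (δ : ℂ) * hexCenter v ∈ T) → (∀ t' : HexVertex, hexGraph.Adj w t' → (δ : ℂ) * hexMidpoint s(w, t') ∉ S) → δ ^ 2 * (∑ᶠ z ∈ {z : Sym2 HexVertex | z ∈ hexDomainMidEdges Λ ∧ ((δ : ℂ) * hexMidpoint z ∈ S ∧ (δ : ℂ) * hexMidpoint z ∉ closure Ω)}, ‖hexParafermionicObservable Λ s(u, w) hexCriticalFugacity (5 / 8) z‖) ≤ 768 * (∑ x ∈ t, Cb x) * δ * ‖hexParafermionicObservable Λ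 s(u, w) hexCriticalFugacity 0 b‖ :=
  fun _ _ _ _ _ _ _ _ _ _ _ _ _ hu hδ hdepthK hCb hrb hbudget hdep hTcl hsplit hroot =>
    offClosure_mesh_le hu hδ hdepthK hCb hrb hbudget hdep hTcl hsplit hroot

end Summit.CriticalPhenomena.SAWScalingLimit.Theorems.PolygonParitySqueeze.PolygonLimitData

end
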